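import Summits.QuantumFields.QCD.Theses.HeatSlicedQuarks
import Literature.MathematicalPhysics.QuantumLattice.WilsonFermionBlockAveraging

/-!
# Stub `stub_unitaryDiagonalCovariance` of line `Sketch` (crux stmt-QuantumFields-8891)

Unitary gauge covariance of the heat slice `exp(-t H_U)` of the Wilson operator
`H_U = D_W(U)ᴴ D_W(U)` over `SU(3)`-valued links: for every gauge transformation `g : Λ → SU(3)`,
`exp(-t H_{U^g}) = 𝒢(g) exp(-t H_U) 𝒢(g⁻¹)`.

Proof: the tree's `wilsonDirac_gaugeTransform` gives `D_W(U^g) = 𝒢 D_W(U) 𝒢'` with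
`𝒢 = gaugeRotation ρ (Fin 4) g`, `𝒢' = gaugeRotation ρ (Fin 4) g⁻¹`, `𝒢𝒢' = 𝒢'𝒢 = 1`
(`gaugeRotation_mul_inv`, `gaugeRotation_inv_mul`); since `ρ = fundamentalRep (Fin 3)` is a
representation by unitary matrices, `𝒢ᴴ = 𝒢'` (entrywise), whence
`H_{U^g} = 𝒢'ᴴ D_Wᴴ 𝒢ᴴ 𝒢 D_W 𝒢' = 𝒢 H_U 𝒢'`; finally `exp` is conjugation-covariant
(Mathlib's `Matrix.exp_units_conj`).
-/

namespace Summit.QuantumFields.QCD.Cruxes.InterleavedHeatSliceFlow.Sketch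

open Literature.MathematicalPhysics.QuantumLattice Literature.MathematicalPhysics.QuantumFieldTheory
  Literature.Probability.LatticeModels
open scoped Matrix Kronecker

/-- For a representation `ρ` by unitary matrices, `(ρ g)ᴴ = ρ g⁻¹`: both are inverses of `ρ g` in
the monoid of matrices. -/
private theorem unitaryDiagonalCovariance_star_rep {G : Type*} [Group G] {N : ℕ}
    (ρ : G →* Matrix (Fin N) (Fin N) ℂ) (hρ : ∀ h, ρ h ∈ Matrix.unitaryGroup (Fin N) ℂ) (g : G) :
    star (ρ g) = ρ g⁻¹ :=
  left_inv_eq_right_inv (Matrix.mem_unitaryGroup_iff'.1 (hρ g))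
    (by rw [← map_mul, mul_inv_cancel, map_one])

/-- For a representation `ρ` by unitary matrices the gauge rotation matrix is unitary, with adjoint
`𝒢(g)ᴴ = 𝒢(g⁻¹)`: entrywise, `𝒢(g)` is `ρ(g x) ⊗ 1` on the diagonal block of the site `x` and
zero between different sites, and `(ρ(g x))ᴴ = ρ((g x)⁻¹)`. -/
private theorem unitaryDiagonalCovariance_conjTranspose_gaugeRotation {X : Type*} [DecidableEq X]
    {G : Type*} [Group G] {N : ℕ} (ρ : G →* Matrix (Fin N) (Fin N) ℂ)
    (hρ : ∀ h, ρ h ∈ Matrix.unitaryGroup (Fin N) ℂ) {σ : Type*} [DecidableEq σ] (g : X → G) :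
    (gaugeRotation ρ σ g)ᴴ = gaugeRotation ρ σ g⁻¹ := by
  ext p q
  simp only [Matrix.conjTranspose_apply, gaugeRotation, Matrix.of_apply, Pi.inv_apply]
  by_cases h : p.1 = q.1
  · have hstar : star (ρ (g q.1) q.2.1 p.2.1) = ρ (g q.1)⁻¹ p.2.1 q.2.1 := by
      rw [← unitaryDiagonalCovariance_star_rep ρ hρ, Matrix.star_apply]
    rw [if_pos h, if_pos h.symm, star_mul', hstar, h, Matrix.one_apply, Matrix.one_apply]
    by_cases h2 : p.2.2 = q.2.2
    · rw [if_pos h2, if_pos h2.symm, star_one]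
    · rw [if_neg h2, if_neg (Ne.symm h2), star_zero]
  · rw [if_neg h, if_neg (Ne.symm h), star_zero]

/-- **Stub `stub_unitaryDiagonalCovariance`** (transport step of the gauge-covariant parametrix):
the heat slice `exp(-t H_U)` of the Wilson operator `H_U = D_W(U)ᴴ D_W(U)` over `SU(3)`-valued
links (tree `wilsonDirac` with `ρ = fundamentalRep (Fin 3)`) is conjugation-covariant under gauge
transformations `g : Λ → SU(3)`:
`exp(-t H_{U^g}) = 𝒢(g) exp(-t H_U) 𝒢(g⁻¹)` with the unitary gauge rotation
`𝒢(g) = gaugeRotation ρ (Fin 4) g`. -/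
theorem stub_unitaryDiagonalCovariance :
    ∀ (L : ℕ) [NeZero L] (g : TorusSite 4 L → Matrix.specialUnitaryGroup (Fin 3) ℂ)
      (U : GaugeConfig 4 L (Matrix.specialUnitaryGroup (Fin 3) ℂ)) (m : ℝ) (t : ℂ),
      NormedSpace.exp (-t • ((wilsonDirac (fundamentalRep (Fin 3)) (gaugeTransform g U) m 1)ᴴ *
          wilsonDirac (fundamentalRep (Fin 3)) (gaugeTransform g U) m 1)) =
        gaugeRotation (fundamentalRep (Fin 3)) (Fin 4) g *
          NormedSpace.exp (-t • ((wilsonDirac (fundamentalRep (Fin 3)) U m 1)ᴴ *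
            wilsonDirac (fundamentalRep (Fin 3)) U m 1)) *
          gaugeRotation (fundamentalRep (Fin 3)) (Fin 4) g⁻¹ := by
  intro L _ g U m t
  set ρ : Matrix.specialUnitaryGroup (Fin 3) ℂ →* Matrix (Fin 3) (Fin 3) ℂ := fundamentalRep (Fin 3)
  have hρ : ∀ h, ρ h ∈ Matrix.unitaryGroup (Fin 3) ℂ := fundamentalRep_mem_unitaryGroup
  -- the gauge rotation `𝒢 = 𝒢(g)`, its inverse `𝒢' = 𝒢(g⁻¹) = 𝒢ᴴ`, and `D = D_W(U)`
  set 𝒢 := gaugeRotation ρ (Fin 4) g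
  set 𝒢' := gaugeRotation ρ (Fin 4) g⁻¹
  set D := wilsonDirac ρ U m 1
  have h1 : 𝒢' * 𝒢 = 1 := gaugeRotation_inv_mul ρ g
  have h2 : 𝒢 * 𝒢' = 1 := gaugeRotation_mul_inv ρ g
  have hH : 𝒢ᴴ = 𝒢' := unitaryDiagonalCovariance_conjTranspose_gaugeRotation ρ hρ g
  have hH' : 𝒢'ᴴ = 𝒢 := by rw [← hH, Matrix.conjTranspose_conjTranspose]
  have hD : wilsonDirac ρ (gaugeTransform g U) m 1 = 𝒢 * D * 𝒢' :=
    wilsonDirac_gaugeTransform ρ g U m 1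
  -- `H_{U^g} = 𝒢 H_U 𝒢'`
  have hHam : (𝒢 * D * 𝒢')ᴴ * (𝒢 * D * 𝒢') = 𝒢 * (Dᴴ * D) * 𝒢' := by
    rw [Matrix.conjTranspose_mul, Matrix.conjTranspose_mul, hH, hH']
    simp only [Matrix.mul_assoc]
    rw [← Matrix.mul_assoc 𝒢' 𝒢, h1, Matrix.one_mul]
  -- `exp` commutes with conjugation by the unit `𝒢` (two-sided inverse `𝒢'`)
  have hexp : NormedSpace.exp (-t • (𝒢 * (Dᴴ * D) * 𝒢')) =
      𝒢 * NormedSpace.exp (-t • (Dᴴ * D)) * 𝒢' := by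
    rw [Matrix.mul_assoc, ← Matrix.mul_smul, ← Matrix.smul_mul, ← Matrix.mul_assoc]
    exact Matrix.exp_units_conj ⟨𝒢, 𝒢', h2, h1⟩ _
  rw [hD, hHam, hexp]

end Summit.QuantumFields.QCD.Cruxes.InterleavedHeatSliceFlow.Sketch
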